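import Summits.ResolutionOfSingularities.ResolutionOfSingularities.Theorems.HilbertSamuelEliminationSigmaMaxModificationsCorridor3WLadderStrataBirthsMovingDefs
import Summits.ResolutionOfSingularities.ResolutionOfSingularities.Theorems.HilbertSamuelEliminationSigmaMaxModificationsCorridor3WLadderStrataDepthBricks
import HarnessLib

/-!
# [OURS · L1 W4.2] `Corridor3WLadderStrataDepth` — res-type-040's structural binder `StrataDepthDiscipline` (D13):
# conjunct (b) «strict transforms keep depth» DISCHARGED BY NAME, and the binder reduced to its conjunct (a)

Crux chain w42 (`SigmaMaxModifications`, stmt-ResolutionOfSingularities-18506; conjunct `SigmaMaxModificationsCorridor3`,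
stmt-ResolutionOfSingularities-19249), object D13-DD «DEPTH DISCIPLINE» (res-L1-w42-plan-1 RULINGS v3.13-3 (AM) 2026-08-27T09:09:15Z
→ res-type-053: «instantiate BY NAME when 040's Defs land»; the Defs landed as `…Corridor3WLadderStrataBirthsMovingDefs`, p517068).
Seat res-type-053 (gen 10). OURS (cell res-hironaka, slot W4.2); NOT statements of H. Hironaka's manuscript [Hironaka2017] nor of
[CossartJannsenSaito2020]; AI-proved, weaker than expert review. Sorry-free PROOF file (no definition, no named fact, no binder).
`--supports stmt-ResolutionOfSingularities-19249 --as helper`.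

`StrataDepthDiscipline p N Q G` (…StrataBirthsMovingDefs :203) is, at every step `X_n ← X_{n+1}` of every chain in scope, the
conjunction of (a) «at a cycle-end step a MOVING-BIRTH newborn `Z' ∋ x_{n+1}` has no sandwich at `x_{n+1}`» and (b) «a component
`Z' ∋ x_{n+1}` dominating a component `cl f(Z')` of `X_n(ν)`, with a sandwich at `x_{n+1}` but none at `x_n`, has `cl f(Z')`
inside the canonical centre». This file:

* `exists_centre_of_hasSandwichAt` — **(b) PROVED BY NAME**, for every `p N Q G`-scope with `ν ≠ Φ^{(N)}` (the rows' `QNe`),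
  at EVERY step (not only eventually) and without the domination hypothesis: it is the centre-free brick
  `StepProjection.exists_centre_of_sandwich_of_mem_componentsThrough` (…StrataDepthBricks, from the LIB file
  `Literature/AlgebraicGeometry/Resolution/BlowupRelativeDimension.lean`: blowing up does not raise the codimension of a point
  inside a strict transform, Matsumura Thm. 15.5 on the Rees charts) fed with the closedness of the marked points
  (`Reaches.isClosed_pt`) and of the strata (`CycleInv.isClosed_hsStratum` along `exists_cycleInv_chain`).
* `strataDepthDiscipline_of_shallowMovingBirths` — **`StrataDepthDiscipline p N (QNe Q) G` FROM CONJUNCT (a) ALONE** (conjunct (a)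
  spelled out as the hypothesis, same binders): the binder D13 consumes is reduced to «moving births are curves».

What remains (conjunct (a), believed at `N = 3`): char-free via the fibre dimension of a permissible blow-up («`π⁻¹(S) → S` has
zero-dimensional fibres over the host surface `S`», CJS p. 46 `F = Proj(A)`, `dim A = dim 𝒪_{X,x} − dim 𝒪_{D,x}` under normal
flatness) and Mathlib's fibre inequality `Ideal.height_le_height_add_of_liesOver` (Matsumura Thm. 15.1) — object D13-DD PHASE 3.
-/

noncomputable section

set_option linter.dupNamespace false

open CategoryTheory AlgebraicGeometry TopologicalSpace Topology Order
open Summit.ResolutionOfSingularities.ResolutionOfSingularities.Theorems.CampaignW42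
open Literature.AlgebraicGeometry.Resolution Literature.RingTheory.HilbertSamuel
open Summit.ResolutionOfSingularities.ResolutionOfSingularities.Theorems.SigmaMaxModificationsCorridor3

namespace Summit.ResolutionOfSingularities.ResolutionOfSingularities.Theorems.SigmaMaxModificationsCorridor3.Moving

universe u

variable {R : ∀ S : Scheme.{u}, CentreSeq S → Prop} {N : ℕ} {ν : ℕ → ℕ}

/-- **CONJUNCT (b) OF `StrataDepthDiscipline`, BY NAME, AT EVERY STEP OF EVERY CHAIN FROM A MAXIMAL ORIGIN WITH `ν ≠ Φ^{(N)}`.**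
Along a chain of canonical near steps (admissible oracle) reached from `MarkedStage.init X x`, `x` a maximal origin, for every
`n`, every step projection `f : X_{n+1} ⟶ X_n` and every component `Z' ∋ x_{n+1}` of `X_{n+1}(ν)`: if `Z'` has a sandwich at
`x_{n+1}` (`HasSandwichAt`) and its image closure has none at `x_n`, then the image closure lies in the canonical centre of the
step. (Blowing up does not raise the codimension of a point inside a strict transform — LIB `IsBlowup.coheight_le_coheight_closure_image`
— and a sandwich at a closed point of an irreducible closed set is `2 ≤ codim`.) [cite: Matsumura1987, Thm. 15.5] -/
theorem exists_centre_of_hasSandwichAt {p : ℕ} (hRa : OracleAdmissible R) (hν : ν ≠ iterPSum N Phi) {X : Scheme.{u}}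
    [IsLocallyNoetherian X] {x : X} (hX : IsMaximalOrigin p N ν X x) {c : ℕ → MarkedStage.{u}}
    (h0 : Reaches R N ν (MarkedStage.init X x) (c 0)) (hstep : ∀ n, CanonicalNearStep R N ν (c n) (c (n + 1))) (n : ℕ)
    {f : (c (n + 1)).W ⟶ (c n).W} (hf : StepProjection R N ν (c n) (c (n + 1)) f) {Z' : Set (c (n + 1)).W}
    (hZ' : Z' ∈ componentsThrough N ν (c (n + 1))) (hup : HasSandwichAt (c (n + 1)) Z')
    (hdown : ¬ HasSandwichAt (c n) (closure (f.base '' Z'))) :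
    ∃ (C : (c n).W.IdealSheafData) (P' : Option (Pending (blowup C))), IsCanonicalStep R N ν (c n).L (c n).P C P' ∧
      closure (f.base '' Z') ⊆ (C.support : Set (c n).W) := by
  obtain ⟨k, _, hinv⟩ := exists_cycleInv_chain hRa hν hX h0 hstep
  exact hf.exists_centre_of_sandwich_of_mem_componentsThrough (Reaches.isClosed_pt hX.isClosed (reaches_chain h0 hstep n))
    (hinv (n + 1)).isClosed_hsStratum hZ' hup hdown

/-- **`StrataDepthDiscipline p N (QNe Q) G` FROM ITS CONJUNCT (a) ALONE** («moving births are curves»: at a cycle-end step a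
moving-birth newborn through the chain point has no sandwich there — spelled out as the hypothesis, with the binders of the row);
conjunct (b) is `exists_centre_of_hasSandwichAt`. [cite: Matsumura1987, Thm. 15.5] -/
theorem strataDepthDiscipline_of_shallowMovingBirths {p N : ℕ} {Q : ℕ → (ℕ → ℕ) → ∀ X : Scheme.{u}, X → Prop}
    {G : MarkedStage.{u} → Prop}
    (ha : ∀ (R : ∀ S : Scheme.{u}, CentreSeq S → Prop), OracleFunctional R → OracleAdmissible R →
      ∀ (ν : ℕ → ℕ) (X : Scheme.{u}) [IsLocallyNoetherian X] (x : X), IsMaximalOrigin p N ν X x → QNe Q N ν X x →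
      ∀ c : ℕ → MarkedStage.{u}, Reaches R N ν (MarkedStage.init X x) (c 0) →
        (∀ n, CanonicalNearStep R N ν (c n) (c (n + 1))) → (∀ n, G (c n)) → (∀ n, ¬ Iso N (c n)) →
        (∀ n, ∃ m, n ≤ m ∧ (c m).IsBlownUp R N ν) →
        ∀ n (f : (c (n + 1)).W ⟶ (c n).W), StepProjection R N ν (c n) (c (n + 1)) f →
          (c (n + 1)).P = none → ∀ Z', IsMovingBirthAt N ν (c n) (c (n + 1)) f Z' → ¬ HasSandwichAt (c (n + 1)) Z') :
    StrataDepthDiscipline p N (QNe Q) G := by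
  intro R hRf hRa ν X _ x hX hQ c h0 hstep hG hnI hmov n f hf
  refine ⟨ha R hRf hRa ν X x hX hQ c h0 hstep hG hnI hmov n f hf, ?_⟩
  intro Z' hZ' _ hup hdown
  exact exists_centre_of_hasSandwichAt hRa hQ.2 hX h0 hstep n hf hZ' hup hdown

end Summit.ResolutionOfSingularities.ResolutionOfSingularities.Theorems.SigmaMaxModificationsCorridor3.Moving

end
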